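import Summits.QuantumFields.YangMills.Theorems.BalabanUVNodesN15KingModelPotentialLogDetDensityDeriv
import Summits.QuantumFields.YangMills.Theorems.BalabanUVNodesN15KingModelPotentialLogDetRate

/-!
# N15 (NE2) King-model rung, PART 46 — THE GAUSSIAN FREE ENERGY PER SITE OF THE DRESSED BLOCK-SPIN COVARIANCES: ONE CITATION POINT (parts 41–45)

Eleventh generation (g11) of the seat `pub-ymgap-dag-n15-d`, part 46 (on 45 `…PotentialLogDetDensityDeriv`, 42 `…PotentialLogDetRate`).  The intensive quantity
`f_k(t) = |Λ|⁻¹·log det(Δ^{(k)}_{t·v} + aL⁻²Q*Q)` (twice the free energy per unit site of the Gaussian block-spin measure with covariance `C^{(k)}_{t·v}`) and its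
response `e_k = |Λ|⁻¹·tr(C^{(k)} ∂Δ^{(k)})`, packaged on the King-admissible tori `Π ℤ∕(2L^{e+1})` (odd `L ≥ 3`, `a, m² > 0`) in ONE statement with ONE window:

★★★ `kingModel_freeEnergy_package` — there are `w₁, A, A′ > 0` such that for every volume exponent `e`, every potential tower `v` of the window
(`sup|v_N| ≤ w₀ ≤ w₁`, `w₀ > 0`, coherence defect `≤ ν₀s^k`) and every real coupling `|t| ≤ 1`:
(a) JACOBI (41): for every `k ≥ 1`, `HasDerivAt f_k (Re e_k(t)) t`;
(b) THE η-RATE OF THE DENSITY, UNIFORM IN THE VOLUME (44): `|f_{k+1}(t) − f_k(t)| ≤ A·(L^{−1∕2})^k` for every `k ≥ 1`, and `f_{k+1}(t)` converges with the tail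
    `A·θ₂^{k+1}∕(1−θ₂)` (`θ₂ = L^{−1∕2}`);
(c) THE η-RATE OF THE RESPONSE, UNIFORM IN THE VOLUME (42, at the real coupling read as a point of the disc with `r = 1∕2`, circle radius `ρ = 1∕12`):
    `‖e_{k+1}(t) − e_k(t)‖ ≤ A′·ϑ^k` for every `k ≥ 1` and `|t| ≤ 1∕12`, `ϑ = (L^{−1∕4})^{1−λ(1∕2)}`;
(d) LIMIT AND DERIVATIVE COMMUTE (45): for `|t| < 1∕6`, `HasDerivAt (t ↦ lim_k f_{k+1}(t)) (Re e_∞(t)) t` with `Im e_∞(t) = 0`, `e_∞ = lim_k e_{k+1}` the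
    holomorphic Vitali limit of 43 (`= |Λ|⁻¹·tr(C^{(∞)}∂Δ^{(∞)})`).
All constants are independent of `k`, of the volume `e` and of `v` (the convergence statements themselves are at fixed volume).

References (method): Jacobi's formula (tree `LogDetDerivative`, port of [AlbergoEtAl2021Fermions] App. C); two-constants (tree `TwoConstantsDisc` ∕ `B13RealSlice*`, BY NAME);
Vitali (28c); uniform limits of derivatives and the mean-value inequality (Mathlib); King Lemma 4.3 (4.18) p.672, (4.32)–(4.34), Lemma 4.5 (4.38) p.674, §4 pp.675–676.

HONEST SCOPE.  King's A = 0 SCALAR model; REAL potential towers, real coupling in (a)(b)(d) ((c) is the complex-disc theorem of 42 read at real points); the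
GAUSSIAN free energy per site at one level — NOT the interacting theory's vacuum energy, NOT Bałaban's `E` of [III] Thm 1, NOT King's renormalisation
constants `Z_k`; NOT a node discharge; count-neutral.  No `sorry`, standard axioms.
-/

noncomputable section

open scoped BigOperators Matrix
open Filter Topology Metric Finset Set

namespace Summit.QuantumFields.YangMills.BalabanUVNodes.N15.KingModel

open Literature.MathematicalPhysics.QuantumFieldTheory.Balaban1983to89 hiding blockOf
open Literature.MathematicalPhysics.QuantumFieldTheory.Balaban1983to89.B4Sect5Proof (latticeConst latticeConst_nonneg)
open Literature.MathematicalPhysics.QuantumFieldTheory.Balaban1983to89.B5Prop11Plancherel (Tor fine)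
open Literature.MathematicalPhysics.QuantumFieldTheory.Balaban1983to89.B13RealSliceEntryLetters (lam lam_nonneg lam_lt_one)
open Literature.MathematicalPhysics.QuantumFieldTheory.King1986.Torus (gam0L gam0L_pos kapCT kapCT_pos_le)
open Summit.QuantumFields.YangMills.BalabanUVNodes.N15KingModelRung.Curved (underPtN)

variable {d : ℕ}

section KingU

variable (L : ℕ) [NeZero L]

/-- ★★★ **THE GAUSSIAN FREE ENERGY PER SITE OF THE DRESSED BLOCK-SPIN COVARIANCES — ONE CITATION POINT** (items (a)–(d) of the module docstring: Jacobi,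
the volume-uniform η-rate of the density with its limit, the volume-uniform η-rate of the response at real couplings `|t| ≤ 1∕12`, and «limit and derivative
commute» on `|t| < 1∕6`). [cite: King1986, Lemma 4.3 (4.18) p.672, (4.32)–(4.34) p.674, Lemma 4.5 (4.38) p.674, §4 pp.675–676 (A = 0 template); AlbergoEtAl2021Fermions, App. C (Jacobi); Ransford1995, Thm. 4.3.7] -/
theorem kingModel_freeEnergy_package (hLodd : Odd L) (hL : 2 ≤ L) {a m2 : ℝ} (ha : 0 < a) (hm : 0 < m2) :
    ∃ w₁ A A' : ℝ, 0 < w₁ ∧ 0 < A ∧ 0 < A' ∧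
      ∀ (e : ℕ) (v : ∀ N : ℕ, Tor (fine N (kingU d L e)) → ℝ) (w₀ ν₀ s : ℝ),
      0 ≤ ν₀ → ν₀ ≤ w₁ → 0 ≤ s → s ≤ (L : ℝ) ^ (-(1 / 2 : ℝ)) →
      0 < w₀ → (∀ (N : ℕ) (x : Tor (fine N (kingU d L e))), |v N x| ≤ w₀) → w₀ ≤ w₁ →
      (∀ (k : ℕ), 1 ≤ k → ∀ x' : Tor (fine (L ^ 1 * L ^ k) (kingU d L e)),
          |v (L ^ 1 * L ^ k) x' - v (L ^ k) (underPtN L k 1 (kingU d L e) x')| ≤ ν₀ * s ^ k) →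
      ∀ (t : ℝ), |t| ≤ 1 →
        let f : ℕ → ℝ → ℝ := fun k t' => logDetDensity a m2 L (kingM d L e) k (v (L ^ k)) t'
        let eR : ℕ → ℂ → ℂ := fun k z => logDetResponseC d a m2 L (kingM d L e) k (v (L ^ k)) z
        let eS : ℕ → ℂ → ℂ := fun k z => eR (k + 1) z
        let θ₂ : ℝ := (L : ℝ) ^ (-(1 / 2 : ℝ))
        let ϑ : ℝ := (((L : ℝ) ^ (-(1 / 4 : ℝ))) ^ (1 - lam (1 / 2)))
        (∀ k, 1 ≤ k → HasDerivAt (f k) ((eR k (t : ℂ)).re) t) ∧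
        ((∀ k, 1 ≤ k → |f (k + 1) t - f k t| ≤ A * θ₂ ^ k) ∧
          Tendsto (fun k => f (k + 1) t) atTop (𝓝 (limUnder atTop (fun k => f (k + 1) t))) ∧
          ∀ k : ℕ, |f (k + 1) t - limUnder atTop (fun k => f (k + 1) t)| ≤ (A * θ₂) * θ₂ ^ k / (1 - θ₂)) ∧
        (|t| ≤ 1 / 12 → ∀ k, 1 ≤ k → ‖eR (k + 1) (t : ℂ) - eR k (t : ℂ)‖ ≤ A' * ϑ ^ k) ∧
        (|t| < 1 / 6 → HasDerivAt (fun t' : ℝ => limUnder atTop (fun k => f (k + 1) t')) ((vitaliLim eS (t : ℂ)).re) t ∧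
          (vitaliLim eS (t : ℂ)).im = 0) := by
  obtain ⟨w₁, A, hw₁, hA, H44⟩ := logDetDensity_limit (d := d) L hLodd hL ha hm
  obtain ⟨w₂, A₂, hw₂, hA₂, H44r⟩ := logDetDensity_twoSpacing_rate (d := d) L hLodd hL ha hm
  obtain ⟨κ₁, κ₂, w₃, C, E, hκ₁, hκ₂, hw₃, hC, hE, H42⟩ := logDetResponseC_twoSpacing_rate (d := d) L hLodd hL ha hm
  obtain ⟨w₄, hw₄, H45⟩ := hasDerivAt_logDetDensity_lim (d := d) L hLodd hL ha hm
  have hwb := (dressedConsts_nonneg (d := d) (a := a) (L := L) ha hL).2.2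
  have hwin := cplxWindow_pos (d := d) (a := a) (m2 := m2) (L := L) ha hm hL
  have hγ := gam0L_pos (d := d + 1) ha hL
  -- the (c)-constant at r = 1/2, ρ = 1/12
  set A' : ℝ := (C ^ (1 - lam (1 / 2 : ℝ)) * (max C (4 / gam0L (d + 1) a L)) ^ lam (1 / 2 : ℝ) * latticeConst (d + 1) ((1 - lam (1 / 2 : ℝ)) * (κ₂ / 2))
        * (max (a + a ^ 2 * ctCK (d + 1) a L) (a + 2 * a ^ 2 / m2) / (1 / 12 : ℝ))
      + 4 / gam0L (d + 1) a L * latticeConst (d + 1) ((1 - lam (1 / 2 : ℝ)) * κ₁)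
        * (E ^ (1 - lam (1 / 2 : ℝ)) * (max E (2 * (a + 2 * a ^ 2 / m2))) ^ lam (1 / 2 : ℝ) / (1 / 12 : ℝ))) + 1 with hA'
  have hlam0 := lam_nonneg (r := (1 / 2 : ℝ)) (by norm_num) (by norm_num)
  have hlam1 := lam_lt_one (1 / 2 : ℝ)
  have hA'0 : 0 < A' := by
    have hCK := (dressedConsts_nonneg (d := d) (a := a) (L := L) ha hL).1
    have h1 : 0 ≤ max C (4 / gam0L (d + 1) a L) := hC.le.trans (le_max_left _ _)
    have h2 : 0 ≤ max E (2 * (a + 2 * a ^ 2 / m2)) := hE.le.trans (le_max_left _ _)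
    have h3 : 0 ≤ max (a + a ^ 2 * ctCK (d + 1) a L) (a + 2 * a ^ 2 / m2) := le_trans (by positivity) (le_max_left _ _)
    have hK1 : 0 ≤ latticeConst (d + 1) ((1 - lam (1 / 2 : ℝ)) * κ₁) := latticeConst_nonneg _ (by nlinarith)
    have hK2 : 0 ≤ latticeConst (d + 1) ((1 - lam (1 / 2 : ℝ)) * (κ₂ / 2)) := latticeConst_nonneg _ (by nlinarith)
    positivity
  -- the common window: the four w's, half of 9c's `w̄` (strictness in 41) and `r_K` (so that `min(r_K∕w₀,1) = 1`)
  set W : ℝ := min (min (min w₁ w₂) (min w₃ w₄)) (min (wbarK (d + 1) a L / 2) (cplxWindow d a m2 L)) with hW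
  refine ⟨W, max A A₂, A', lt_min (lt_min (lt_min hw₁ hw₂) (lt_min hw₃ hw₄)) (lt_min (half_pos hwb) hwin), lt_max_of_lt_left hA, hA'0, ?_⟩
  intro e v w₀ ν₀ s hν₀ hν₁ hs0 hs1 hw₀ hv hw₁' hcoh t ht f eR eS θ₂ ϑ
  have hW1 : W ≤ w₁ := (min_le_left _ _).trans ((min_le_left _ _).trans (min_le_left _ _))
  have hW2 : W ≤ w₂ := (min_le_left _ _).trans ((min_le_left _ _).trans (min_le_right _ _))
  have hW3 : W ≤ w₃ := (min_le_left _ _).trans ((min_le_right _ _).trans (min_le_left _ _))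
  have hW4 : W ≤ w₄ := (min_le_left _ _).trans ((min_le_right _ _).trans (min_le_right _ _))
  have hWb : W ≤ wbarK (d + 1) a L / 2 := (min_le_right _ _).trans (min_le_left _ _)
  have hWK : W ≤ cplxWindow d a m2 L := (min_le_right _ _).trans (min_le_right _ _)
  have hwbar2 : w₀ ≤ wbarK (d + 1) a L / 2 := hw₁'.trans hWb
  have hwK : w₀ ≤ cplxWindow d a m2 L := hw₁'.trans hWK
  have htw0 : |t| * w₀ ≤ w₀ := by nlinarith [abs_nonneg t]
  -- the disc data at r = 1/2: min(r_K/w₀, 1) = 1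
  have hmin1 : min (cplxWindow d a m2 L / w₀) 1 = 1 := min_eq_right ((one_le_div hw₀).mpr hwK)
  refine ⟨fun k hk => ?_, ⟨fun k hk => ?_, ?_⟩, fun ht' k hk => ?_, fun ht' => ?_⟩
  · -- (a) Jacobi (41)
    have htw : |t| * w₀ < wbarK (d + 1) a L := by linarith
    have htc : |t| * w₀ ≤ cplxWindow d a m2 L := htw0.trans hwK
    obtain ⟨hD, hid⟩ := hasDerivAt_logDetDensity (M := kingM d L e) ha hm hL hk hw₀.le (hv (L ^ k)) htw htc
    have hval : (eR k (t : ℂ)).re = ((Fintype.card (Tor (kingU d L e)) : ℝ))⁻¹ *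
        ((kingLevelPot a m2 L (kingM d L e) k (t • v (L ^ k)) + kingBlock a L (kingM d L e))⁻¹ * dLevel a m2 L (kingM d L e) k (v (L ^ k)) t).trace := by
      show (logDetResponseC d a m2 L (kingM d L e) k (v (L ^ k)) (t : ℂ)).re = _
      rw [hid, Complex.ofReal_re]
    rw [hval]
    exact hD
  · -- (b) the density's η-rate (44)
    have h := H44r e v w₀ ν₀ s hν₀ (hν₁.trans hW2) hs0 hs1 hv (hw₁'.trans hW2) hcoh t ht k hk
    exact h.trans (mul_le_mul_of_nonneg_right (le_max_right _ _) (pow_nonneg (Real.rpow_nonneg (Nat.cast_nonneg _) _) k))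
  · -- (b) the density's limit (44)
    obtain ⟨hlim, htail⟩ := H44 e v w₀ ν₀ s hν₀ (hν₁.trans hW1) hs0 hs1 hv (hw₁'.trans hW1) hcoh t ht
    refine ⟨hlim, fun k => (htail k).trans ?_⟩
    have hθ0 : 0 ≤ θ₂ := Real.rpow_nonneg (Nat.cast_nonneg _) _
    have hθ1 : θ₂ < 1 := by
      have hL1 : (1 : ℝ) < L := by exact_mod_cast (by omega : 1 < L)
      exact Real.rpow_lt_one_of_one_lt_of_neg hL1 (by norm_num)
    have h1θ : 0 < 1 - θ₂ := by linarith
    exact div_le_div_of_nonneg_right (mul_le_mul_of_nonneg_right (mul_le_mul_of_nonneg_right (le_max_left _ _) hθ0) (pow_nonneg hθ0 k)) h1θ.le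
  · -- (c) the response's η-rate at the real coupling (42 at r = 1/2, ρ = 1/12)
    have hzρ : ‖(t : ℂ)‖ + (1 / 12 : ℝ) < (1 / 2 : ℝ) / (1 + 1 / 2) * min (cplxWindow d a m2 L / w₀) 1 := by
      rw [hmin1, Complex.norm_real, Real.norm_eq_abs]
      norm_num
      linarith
    have h := H42 e v w₀ ν₀ s hν₀ (hν₁.trans hW3) hs0 hs1 hw₀ hv (hw₁'.trans hW3) hcoh (1 / 2) (by norm_num) (by norm_num) (t : ℂ) (1 / 12)
      (by norm_num) hzρ k hk
    refine h.trans (mul_le_mul_of_nonneg_right (by rw [hA']; linarith) ?_)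
    exact pow_nonneg (Real.rpow_nonneg (Real.rpow_nonneg (Nat.cast_nonneg _) _) _) k
  · -- (d) limit and derivative commute (45 at r = 1/2, ρ₀ = 1/6)
    have hρR : (1 / 6 : ℝ) < (1 / 2 : ℝ) / (1 + 1 / 2) * min (cplxWindow d a m2 L / w₀) 1 := by rw [hmin1]; norm_num
    obtain ⟨-, H⟩ := H45 e v w₀ ν₀ s hν₀ (hν₁.trans hW4) hs0 hs1 hw₀ hv (hw₁'.trans hW4) hcoh (1 / 2) (by norm_num) (by norm_num) (1 / 6)
      (by norm_num) hρR
    have htR : |t| < (1 / 2 : ℝ) / (1 + 1 / 2) * min (cplxWindow d a m2 L / w₀) 1 - 1 / 6 := by rw [hmin1]; norm_num; linarith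
    exact H t htR

end KingU

end Summit.QuantumFields.YangMills.BalabanUVNodes.N15.KingModel

end
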